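import Summits.AnomalousDissipation.AnomalousDissipation.Theorems.SolenoidalFractalHomogenisationLagrangianStepOneLevelDefsSectorial
import HarnessLib

/-!
# K1L `LagrangianRenormalisationStep(Design)` (K1L_D, stmt-AnomalousDissipation-27980), stub `stub_cellLawV0_IS` — the odd half of the SECTORIAL
# interval window clause from a `τ`-RESTRICTED odd-channel bound `SectorialOddChannelBoundOn … τ₀` (helper; `--supports stmt-AnomalousDissipation-27980`)

Summits-side helper file of route `SolenoidalFractalHomogenisation`.  Tenure ACK W5-CERT-1 (cell STATUS 2026-08-28T15:08:53Z, to this seat: «take the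
odd-half input in p5's RESTRICTED form `SectorialOddChannelBoundOn Φν S⋆ λ₀ Λ κ ε τ₀` (∀ τ ∈ [0, τ₀]) — `sectorialIntervalWindowClause_of_channelBound`
only instantiates τ ∈ [τlo, τhi]») and planner ad-ideate-p5's amendment 15:20:56Z («take τ₀ = 1 for the true map Φ_ν»): p5's certificate W5-CERT-1
(`Cruxes/LagrangianRenormalisationStep/OddGainCertificateSketch.lean` v3 / `SectorCert-Profile.md`) delivers a strict sectorial gain `κ < 1` only for
half-angles `τ ∈ [0, τ₀]` (non-expansion `κ = 1` for all `τ` — landed as `…LagrangianStepOddNonExpansion`, p644915), so the consumer of the landed glue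
`sectorialIntervalWindowClause_of_channelBound` (p636518; hypothesis `SectorialOddChannelBound`, ALL `τ ≥ 0`) needs its `τ`-local twin:
* `SectorialOddChannelBoundOn` — VERBATIM copy of the sketch's definition (identical to the landed `SectorialOddChannelBound` except `τ ∈ Set.Icc 0 τ₀`),
  with `sectorialOddChannelBoundOn_of_global` (VERBATIM) and monotonicity in `τ₀`;
* `sectorialIntervalWindowClause_of_channelBoundOn` — the landed glue with the hypothesis weakened to the local bound plus `τhi ≤ τ₀`: NOTHING ELSE
  CHANGES (the clause quantifies `τ ∈ [τlo, τhi] ⊆ [0, τ₀]`); the fixed-point inequality is the landed `sector_fix_of_gain_lt_one`.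
No named facts, no sorry.  Infrastructure for route-1's rung leaf F-D1.A0 (frontier FORMAL rung); NOT a proof of the stub, of the crux, of Onsager's
conjecture or of anomalous dissipation.  Prover seat `ad-k1l-cellLawV-w1` g0, 2026-08-28.
-/

set_option linter.dupNamespace false

namespace Summit.AnomalousDissipation.AnomalousDissipation.Theorems.SolenoidalFractalHomogenisation.LagrangianStep

open Literature.Analysis Literature.Analysis.FluidPDE Literature.Analysis.FunctionSpaces
open MeasureTheory Set Filter
open scoped ENNReal NNReal InnerProductSpace

noncomputable section

/-- The LOCAL (τ-restricted) form of p4's `SectorialOddChannelBound` — identical except `τ ∈ [0, τ₀]`.  Its consumer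
`sectorialIntervalWindowClause_of_channelBound` only ever instantiates `τ ∈ [τlo, τhi]`, so with `τhi ≤ τ₀` nothing downstream changes.
(VERBATIM copy of `Cruxes/LagrangianRenormalisationStep/OddGainCertificateSketch.lean` `SectorialOddChannelBoundOn`, planner ad-ideate-p5 g7.) -/
def SectorialOddChannelBoundOn (Φν : T4 → T4) (Sstar : T4) (lam₀ Λ κ ε τ₀ : ℝ) : Prop :=
  ∀ lam ∈ Set.Icc lam₀ Λ, ∀ S : T4, ∀ τ ∈ Set.Icc 0 τ₀, InInterval Sstar lam S → OddSectorial S τ → OddSectorial (Φν S) (κ * τ + ε)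

/-- The global bound gives the local one for every `τ₀` (VERBATIM copy of the sketch's `sectorialOddChannelBoundOn_of_global`). [folklore] -/
theorem sectorialOddChannelBoundOn_of_global {Φν : T4 → T4} {Sstar : T4} {lam₀ Λ κ ε : ℝ}
    (h : SectorialOddChannelBound Φν Sstar lam₀ Λ κ ε) (τ₀ : ℝ) : SectorialOddChannelBoundOn Φν Sstar lam₀ Λ κ ε τ₀ :=
  fun lam hlam S τ hτ hSi hSo => h lam hlam S τ hτ.1 hSi hSo

/-- The local bound is monotone in the range: `τ₀' ≤ τ₀` restricts it. [folklore] -/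
theorem SectorialOddChannelBoundOn.mono {Φν : T4 → T4} {Sstar : T4} {lam₀ Λ κ ε τ₀ τ₀' : ℝ}
    (h : SectorialOddChannelBoundOn Φν Sstar lam₀ Λ κ ε τ₀) (hle : τ₀' ≤ τ₀) : SectorialOddChannelBoundOn Φν Sstar lam₀ Λ κ ε τ₀' :=
  fun lam hlam S τ hτ hSi hSo => h lam hlam S τ ⟨hτ.1, hτ.2.trans hle⟩ hSi hSo

/-- The local bound is monotone in the aspect interval: `[λ₀', Λ'] ⊆ [λ₀, Λ]` restricts it. [folklore] -/
theorem SectorialOddChannelBoundOn.mono_aspect {Φν : T4 → T4} {Sstar : T4} {lam₀ Λ lam₀' Λ' κ ε τ₀ : ℝ}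
    (h : SectorialOddChannelBoundOn Φν Sstar lam₀ Λ κ ε τ₀) (hlo : lam₀ ≤ lam₀') (hhi : Λ' ≤ Λ) :
    SectorialOddChannelBoundOn Φν Sstar lam₀' Λ' κ ε τ₀ :=
  fun lam hlam S τ hτ hSi hSo => h lam ⟨hlo.trans hlam.1, hlam.2.trans hhi⟩ S τ hτ hSi hSo

/-- **The odd half of `SectorialIntervalWindowClause` from the LOCAL gain + source bound.**  If `κ, ε ≥ 0`, `κ·τ + ε ≤ τ` for `τ ∈ [τlo, τhi]`
(for `κ < 1`: `τlo ≥ ε/(1-κ)`, `sector_fix_of_gain_lt_one`), `0 ≤ τlo`, `τhi ≤ τ₀`, and the EVEN half holds (it may use the sector hypothesis), then the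
full clause holds — the landed `sectorialIntervalWindowClause_of_channelBound` with `SectorialOddChannelBound` weakened to `SectorialOddChannelBoundOn … τ₀`.
[folklore] -/
theorem sectorialIntervalWindowClause_of_channelBoundOn {Φν : T4 → T4} {Sstar : T4} {slo shi lam₀ Λ τlo τhi μ κ ε τ₀ : ℝ}
    (hstar : Torus.NearIso Sstar slo shi) (hslo : 0 ≤ slo) (hlam₀ : 1 ≤ lam₀) (hiso : InInterval Sstar lam₀ (Torus.isoVisc 1)) (hμ : 1 ≤ μ)
    (hκ : 0 ≤ κ) (hε : 0 ≤ ε) (hτlo : 0 ≤ τlo) (hτhi : τhi ≤ τ₀) (hfix : ∀ τ ∈ Set.Icc τlo τhi, κ * τ + ε ≤ τ)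
    (hodd : SectorialOddChannelBoundOn Φν Sstar lam₀ Λ κ ε τ₀)
    (heven : ∀ τ ∈ Set.Icc τlo τhi, ∀ lam ∈ Set.Icc lam₀ Λ, ∀ S : T4, OddSectorial S τ → InInterval Sstar lam S →
      InInterval Sstar (μ * lam) (Φν S)) :
    SectorialIntervalWindowClause Φν Sstar slo shi lam₀ Λ τlo τhi μ := by
  refine ⟨hstar, hlam₀, hiso, fun τ hτ lam hlam S hSo hSi => ?_⟩
  have hΦi := heven τ hτ lam hlam S hSo hSi
  have hτ0 : 0 ≤ τ := hτlo.trans hτ.1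
  have hlam1 : 1 ≤ lam := hlam₀.trans hlam.1
  have hμlam1 : 1 ≤ μ * lam := one_le_mul_of_one_le_of_one_le hμ hlam1
  have hΦnn : TransNonneg (Φν S) :=
    transNonneg_of_nearIso (InInterval.nearIso hμlam1 hstar hΦi) (div_nonneg hslo (zero_le_one.trans hμlam1))
  have h := hodd lam hlam S τ ⟨hτ0, hτ.2.trans hτhi⟩ hSi hSo
  exact ⟨h.mono hΦnn (by positivity) (hfix τ hτ), hΦi⟩

/-- The same with the fixed-point inequality discharged by `0 ≤ κ < 1` and `ε/(1−κ) ≤ τlo` (`sector_fix_of_gain_lt_one`): the form in which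
p5's certificate (`κ = γ_cert(Λ²·(1+10⁻⁵)) < 1` on `τ ∈ [0, 1]`) and the ν-uniform mixing source `ε` enter the (V) witnesses of `stub_cellLawV0_IS`
(tenure DESIGN READ-OFF 15:08:53Z: `ΛV ≤ 2`, `τlo ≥ ε/(1−κ)`, `τhi ≤ τ₀ = 1`). [folklore] -/
theorem sectorialIntervalWindowClause_of_channelBoundOn_of_gain_lt_one {Φν : T4 → T4} {Sstar : T4}
    {slo shi lam₀ Λ τlo τhi μ κ ε τ₀ : ℝ}
    (hstar : Torus.NearIso Sstar slo shi) (hslo : 0 ≤ slo) (hlam₀ : 1 ≤ lam₀) (hiso : InInterval Sstar lam₀ (Torus.isoVisc 1)) (hμ : 1 ≤ μ)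
    (hκ : 0 ≤ κ) (hκ1 : κ < 1) (hε : 0 ≤ ε) (hτlo : ε / (1 - κ) ≤ τlo) (hτhi : τhi ≤ τ₀)
    (hodd : SectorialOddChannelBoundOn Φν Sstar lam₀ Λ κ ε τ₀)
    (heven : ∀ τ ∈ Set.Icc τlo τhi, ∀ lam ∈ Set.Icc lam₀ Λ, ∀ S : T4, OddSectorial S τ → InInterval Sstar lam S →
      InInterval Sstar (μ * lam) (Φν S)) :
    SectorialIntervalWindowClause Φν Sstar slo shi lam₀ Λ τlo τhi μ :=
  have hτlo0 : 0 ≤ τlo := le_trans (div_nonneg hε (by linarith)) hτlo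
  sectorialIntervalWindowClause_of_channelBoundOn hstar hslo hlam₀ hiso hμ hκ hε hτlo0 hτhi
    (sector_fix_of_gain_lt_one hκ1 hτlo) hodd heven

end

end Summit.AnomalousDissipation.AnomalousDissipation.Theorems.SolenoidalFractalHomogenisation.LagrangianStep
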